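import Literature.Topology.FourManifolds.SliceCartesian
import Mathlib.Analysis.Calculus.Deriv.MeanValue
import HarnessLib

/-!
# Cartesian twisted height along a circle: it decreases exactly in the left half-plane

Topic `Literature/Topology/FourManifolds`; fact seat `provefact-IsStrictHandleSlide.isSurgery`
(R. C. Kirby, *The Topology of 4-Manifolds*, LNM 1374 (1989), Ch. I §4, Fig. 4.2; remaining content:
the named fact (S) `Literature.Topology.FourManifolds.FramedLink.IsStrictHandleSlide.slideModel`).
Continuation of `SliceCartesian.lean`. Along the circle of radius `r` (the push-off is `r = 1`)
the Cartesian twisted height `θ ↦ sliceY c r (cos θ) (sin θ) = r · 2E sin θ / D(θ)`,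
`E = e^{cr}`, `D = (1 + cos θ) + E² (1 - cos θ)`, has derivative
`r · 2E ((1 + E²) cos θ - (E² - 1)) / D²` (`hasDerivAt_sliceY_circle`), which is negative exactly
when `(1 + E²) cos θ < E² - 1`, i.e. exactly when the twisted abscissa
`sliceX = r ((1 + cos θ) - E² (1 - cos θ)) / D` is negative (`deriv_sliceY_circle_neg_iff`): **on the
push-off the route descends in twisted height precisely while it is in the left half-plane of the
twisted chart** — from the lower landing (where the twist angle has passed `π/2`) through the far
point to the upper landing, with no special treatment of the far point.

## References

* R. C. Kirby, *The Topology of 4-Manifolds*, LNM 1374, Springer (1989), Ch. I §4. [Kirby1989]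
-/

open scoped ContDiff Topology
open Set Real Filter

noncomputable section

namespace Literature.Topology.FourManifolds

/-- **The derivative of the Cartesian twisted height along a circle.** [folklore] -/
theorem hasDerivAt_sliceY_circle (c r θ : ℝ) :
    HasDerivAt (fun θ ↦ sliceY c r (cos θ) (sin θ))
      (r * (2 * exp (c * r) * ((1 + exp (c * r) ^ 2) * cos θ - (exp (c * r) ^ 2 - 1)) / sliceD c r (cos θ) ^ 2)) θ := by
  have hD : HasDerivAt (fun θ ↦ sliceD c r (cos θ)) (-sin θ + exp (c * r) ^ 2 * (0 - -sin θ)) θ := by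
    unfold sliceD
    exact ((hasDerivAt_cos θ).const_add 1).add (((hasDerivAt_const θ (1:ℝ)).sub (hasDerivAt_cos θ)).const_mul _)
  have hDpos := sliceD_cos_pos c r θ
  have hq : HasDerivAt (fun θ ↦ sin θ / sliceD c r (cos θ))
      ((cos θ * sliceD c r (cos θ) - sin θ * (-sin θ + exp (c * r) ^ 2 * (0 - -sin θ))) / sliceD c r (cos θ) ^ 2) θ :=
    (hasDerivAt_sin θ).div hD hDpos.ne'
  have h := (hq.const_mul (2 * exp (c * r))).const_mul r
  have e : (fun θ ↦ sliceY c r (cos θ) (sin θ)) = fun θ ↦ r * (2 * exp (c * r) * (sin θ / sliceD c r (cos θ))) := by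
    funext θ; rw [sliceY]; ring
  rw [e]
  have key : cos θ * sliceD c r (cos θ) - sin θ * (-sin θ + exp (c * r) ^ 2 * (0 - -sin θ)) =
      (1 + exp (c * r) ^ 2) * cos θ - (exp (c * r) ^ 2 - 1) := by
    rw [sliceD]
    linear_combination (1 - exp (c * r) ^ 2) * sin_sq_add_cos_sq θ
  refine h.congr_deriv ?_
  rw [key]; ring

/-- The sign of the derivative is that of `(1 + E²) cos θ - (E² - 1)`, and the sign of the
twisted abscissa on the circle is the same: `sliceX c r (cos θ) (sin θ) = r ((1+E²) cos θ - (E²-1)) / D`.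
[folklore] -/
theorem sliceX_circle_eq (c r θ : ℝ) :
    sliceX c r (cos θ) (sin θ) = r * (((1 + exp (c * r) ^ 2) * cos θ - (exp (c * r) ^ 2 - 1)) / sliceD c r (cos θ)) := by
  rw [sliceX]; congr 1; congr 1; ring

/-- **On a circle the twisted height decreases exactly in the left half-plane** (`r > 0`):
`deriv < 0 ↔ sliceX < 0`. [cite: Kirby1989, Ch. I §4] -/
theorem deriv_sliceY_circle_neg_iff (c : ℝ) {r : ℝ} (hr : 0 < r) (θ : ℝ) :
    deriv (fun θ ↦ sliceY c r (cos θ) (sin θ)) θ < 0 ↔ sliceX c r (cos θ) (sin θ) < 0 := by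
  rw [(hasDerivAt_sliceY_circle c r θ).deriv, sliceX_circle_eq]
  have hDpos := sliceD_cos_pos c r θ
  have hE : 0 < exp (c * r) := exp_pos _
  set N := (1 + exp (c * r) ^ 2) * cos θ - (exp (c * r) ^ 2 - 1) with hN
  constructor
  · intro h
    have : N < 0 := by
      by_contra hge
      have hge' : 0 ≤ N := le_of_not_gt hge
      have : 0 ≤ r * (2 * exp (c * r) * N / sliceD c r (cos θ) ^ 2) := by positivity
      linarith
    have : r * (N / sliceD c r (cos θ)) < 0 := mul_neg_of_pos_of_neg hr (div_neg_of_neg_of_pos this hDpos)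
    simpa using this
  · intro h
    have hN0 : N < 0 := by
      by_contra hge
      have hge' : 0 ≤ N := le_of_not_gt hge
      have : 0 ≤ r * (N / sliceD c r (cos θ)) := by positivity
      linarith
    have : r * (2 * exp (c * r) * N / sliceD c r (cos θ) ^ 2) < 0 := by
      apply mul_neg_of_pos_of_neg hr
      apply div_neg_of_neg_of_pos _ (by positivity)
      nlinarith
    exact this

/-- **Strict descent on an arc in the left half-plane.** If along `[θ₁, θ₂]` the circle point stays
in the open left half-plane of the twisted chart, the twisted height is strictly decreasing there.
[cite: Kirby1989, Ch. I §4] -/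
theorem strictAntiOn_sliceY_circle (c : ℝ) {r θ₁ θ₂ : ℝ} (hr : 0 < r)
    (hleft : ∀ θ ∈ Icc θ₁ θ₂, sliceX c r (cos θ) (sin θ) < 0) :
    StrictAntiOn (fun θ ↦ sliceY c r (cos θ) (sin θ)) (Icc θ₁ θ₂) := by
  refine strictAntiOn_of_deriv_neg (convex_Icc _ _) (contDiff_sliceY_circle c r).continuous.continuousOn ?_
  intro θ hθ
  rw [interior_Icc] at hθ
  exact (deriv_sliceY_circle_neg_iff c hr θ).2 (hleft θ (Ioo_subset_Icc_self hθ))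

end Literature.Topology.FourManifolds
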